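import Summits.BirchSwinnertonDyer.BirchSwinnertonDyer.Theorems.AdditiveKolyvaginRoadManinFrameResidueProperRTameTwistCharacter
import HarnessLib

/-!
# Route `AdditiveKolyvaginRoad`, crux `ManinFrameResidueProperR` (stmt-BirchSwinnertonDyer-20709), line
# `birth`, stub TDS: the tame-twist lever on the LARGER locus (A⁺) «no `ℓ ∥ N` with `ℓ ≡ ±a_ℓ (mod p)`»,
# part 1 — unit Euler factors when `gcd(d′ − 1, p − 1) = 2`, and one odd character — `--supports`, helper

Cell `pub/bsd-wall`, seat `bsd-wall-manin-p1` g3. THEOREMS ONLY (the Literature fact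
`kato_neron_isIntegral_twistedSymbolSum_of_additive` is the hypothesis `hK`). With the auxiliary prime taken
`d′ ≡ 3 (mod 4)` (`…RTameTwistMod4`), `n = d′ − 1` has `gcd(n, p − 1) ∣ 2`, so `p ∣ ℓⁿ − aⁿ` forces
`(ℓ/a)² = 1`; hence the hypothesis of the lever weakens from (A²) (`ord_p(ℓ/a_ℓ)` not a `2`-power) to
**(A⁺)**: `(ℓ/a_ℓ)² ≠ 1 (mod p)`, i.e. `ℓ ≢ ±a_ℓ (mod p)`, for every `ℓ ∥ N`. Census (Cremona, the
`bsd-wall` Manin register, `p ≥ 11` additive rank-1 residue cells, N ≤ 5·10⁵): (A²) 324/458, (A⁺) 424/458,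
and 7 of the 9 outside-print cells. No `sorry`; nothing is closed.
-/

set_option autoImplicit false
set_option linter.dupNamespace false

noncomputable section

open scoped Classical MatrixGroups

open WeierstrassCurve NumberField Literature.NumberTheory.EllipticCurves
  Literature.NumberTheory.EllipticCurves.ModularForms
  Literature.NumberTheory.EllipticCurves.Rank1Residual
  Literature.NumberTheory.DiophantineGeometry IsDedekindDomain Rat.HeightOneSpectrum
  Summit.BirchSwinnertonDyer.Rank1Residual Summit.BirchSwinnertonDyer.Rank1Residual.Additive
  CongruenceSubgroup Complex

namespace Summit.BirchSwinnertonDyer.BirchSwinnertonDyer.Theorems.ManinFrameResidueProperRTameTwist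

/-! ### §1 Unit Euler factors under (A⁺) -/

section EulerPlus

variable {p : ℕ}

/-- **`p ∤ ℓⁿ − aⁿ` when `(ℓ/a)² ≠ 1 (mod p)` and `gcd(n, p − 1) ∣ 2`.** Let `p` be a prime, `ℓ` prime to `p`,
`(ℓ/a)² ≠ 1` in `ℤ/p` (i.e. `ℓ ≢ ±a`, or `p ∣ a`). If every odd prime factor of `p − 1` fails to divide
`n ≠ 0` and `4 ∤ n`, then `p ∤ ℓⁿ − aⁿ`: otherwise `ord_p(ℓ/a) ∣ gcd(n, p − 1) ∣ 2`. [folklore] -/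
theorem not_dvd_pow_sub_pow_of_sq_ne_one [hp : Fact p.Prime] {ℓ a : ℤ} (hℓ : ((ℓ : ZMod p)) ≠ 0)
    (hA : ((ℓ : ZMod p) / (a : ZMod p)) ^ 2 ≠ 1) {n : ℕ} (hn : n ≠ 0)
    (hr : ∀ r : ℕ, r.Prime → r ≠ 2 → r ∣ p - 1 → ¬ r ∣ n) (h4 : ¬ 4 ∣ n) :
    ¬ (p : ℤ) ∣ ℓ ^ n - a ^ n := by
  intro hdvd
  have h0 : ((ℓ : ZMod p)) ^ n = ((a : ZMod p)) ^ n := by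
    have : (((ℓ ^ n - a ^ n : ℤ)) : ZMod p) = 0 := (ZMod.intCast_zmod_eq_zero_iff_dvd _ p).mpr hdvd
    push_cast at this
    exact sub_eq_zero.mp this
  by_cases ha : ((a : ZMod p)) = 0
  · rw [ha, zero_pow hn] at h0
    exact pow_ne_zero n hℓ h0
  set u : ZMod p := (ℓ : ZMod p) / (a : ZMod p) with hu
  have hu1 : u ^ n = 1 := by
    rw [hu, div_pow, h0, div_self (pow_ne_zero n ha)]
  have hu0 : u ≠ 0 := by
    rw [hu]; exact div_ne_zero hℓ ha
  -- `ord u ∣ n` and `ord u ∣ p − 1`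
  have hord_n : orderOf u ∣ n := orderOf_dvd_of_pow_eq_one hu1
  have hord_p : orderOf u ∣ p - 1 := orderOf_dvd_of_pow_eq_one (ZMod.pow_card_sub_one_eq_one hu0)
  have hordpos : 0 < orderOf u := orderOf_pos_iff.mpr (isOfFinOrder_iff_pow_eq_one.mpr ⟨n, Nat.pos_of_ne_zero hn, hu1⟩)
  -- `ord u = 2^k · m` with `m` odd; `m = 1` since an odd prime factor of `m` would divide `n` and `p − 1`
  obtain ⟨k, m, hm, hkm⟩ := Nat.exists_eq_two_pow_mul_odd hordpos.ne'
  have hm1 : m = 1 := by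
    by_contra hm1
    obtain ⟨r, hrp, hrm⟩ := Nat.exists_prime_and_dvd hm1
    have hr2 : r ≠ 2 := by
      rintro rfl
      exact (Nat.not_even_iff_odd.mpr hm) (even_iff_two_dvd.mpr hrm)
    have hrord : r ∣ orderOf u := hkm ▸ dvd_mul_of_dvd_right hrm _
    exact hr r hrp hr2 (hrord.trans hord_p) (hrord.trans hord_n)
  rw [hm1, mul_one] at hkm
  -- `2^k ∣ n` with `4 ∤ n` forces `k ≤ 1`, so `u² = 1`
  have hk1 : k ≤ 1 := by
    by_contra hk
    have : 4 ∣ 2 ^ k := by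
      rw [show (4 : ℕ) = 2 ^ 2 by norm_num]; exact Nat.pow_dvd_pow 2 (by omega)
    exact h4 (this.trans (hkm ▸ hord_n))
  have hu2 : u ^ 2 = 1 := by
    have h1 : u ^ 2 ^ k = 1 := by rw [← hkm]; exact pow_orderOf_eq_one u
    interval_cases k
    · rw [pow_zero, pow_one] at h1; rw [h1, one_pow]
    · simpa using h1
  exact hA hu2

/-- **The symmetric Euler factor at `ℓ ∥ N` is a `p`-unit** under (A⁺): for `ζ` with `ζⁿ = 1` (`n > 0`
avoiding the odd primes of `p − 1`, `4 ∤ n`), `ℓ ≢ 0 (mod p)` and `(ℓ/a)² ≠ 1 (mod p)`, the factor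
`(ℓ − aζ)(ℓ − aζ⁻¹)` times an algebraic integer is an integer prime to `p`. [folklore] -/
theorem exists_symmEulerFactor_mul_eq_of_sq_ne_one [hp : Fact p.Prime] (ℓ : ℕ) (a : ℤ)
    (hℓ : ((ℓ : ZMod p)) ≠ 0) (hA : ((ℓ : ZMod p) / (a : ZMod p)) ^ 2 ≠ 1)
    {n : ℕ} (hn : 0 < n) (hr : ∀ r : ℕ, r.Prime → r ≠ 2 → r ∣ p - 1 → ¬ r ∣ n) (h4 : ¬ 4 ∣ n)
    {ζ : ℂ} (hζ : ζ ^ n = 1) :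
    ∃ (w : ℂ) (t : ℤ), IsIntegral ℤ w ∧
      (((ℓ : ℂ) - (a : ℂ) * ζ) * ((ℓ : ℂ) - (a : ℂ) * ζ⁻¹)) * w = t ∧ ¬ (p : ℤ) ∣ t := by
  have hℓ' : (((ℓ : ℤ) : ZMod p)) ≠ 0 := by simpa using hℓ
  have hA' : (((ℓ : ℤ) : ZMod p) / (a : ZMod p)) ^ 2 ≠ 1 := by simpa using hA
  have hζ' : ζ⁻¹ ^ n = 1 := by rw [inv_pow, hζ, inv_one]
  obtain ⟨w₁, hw₁, he₁⟩ := exists_eulerFactor_mul_eq (ℓ : ℤ) a hn hζ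
  obtain ⟨w₂, hw₂, he₂⟩ := exists_eulerFactor_mul_eq (ℓ : ℤ) a hn hζ'
  have ht : ¬ (p : ℤ) ∣ (ℓ : ℤ) ^ n - a ^ n := not_dvd_pow_sub_pow_of_sq_ne_one hℓ' hA' hn.ne' hr h4
  refine ⟨w₁ * w₂, ((ℓ : ℤ) ^ n - a ^ n) * ((ℓ : ℤ) ^ n - a ^ n), hw₁.mul hw₂, ?_,
    fun hdvd ↦ ((Int.prime_iff_natAbs_prime.mpr (by simpa using hp.out)).dvd_or_dvd hdvd).elim ht ht⟩
  push_cast at he₁ he₂ ⊢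
  linear_combination ((ℓ : ℂ) - (a : ℂ) * ζ⁻¹) * w₂ * he₁ + ((ℓ : ℂ) ^ n - (a : ℂ) ^ n) * he₂


end EulerPlus

/-! ### §2 One odd character under (A⁺) -/

section OneCharacterPlus

variable {W : WeierstrassCurve ℚ} [W.IsElliptic] [W.IsGloballyMinimal] {N : ℕ} [NeZero N]
  {p : ℕ} [hp : Fact p.Prime]

/-- **One odd character, (A⁺) form.** GRANTED the fact: for `W` globally minimal, additive at `p > 7`, `E[p]`
irreducible, newform `f` at a level `N` with `p² ∣ N` satisfying (A⁺) (`(ℓ/a_ℓ)² ≠ 1 (mod p)` for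
`ℓ ∥ N`), a prime `d′ > N` with `d′ ≡ 3 (4)`, `p ∤ d′ − 1`, `r ∤ d′ − 1` for odd primes `r ∣ p − 1`, and an
ODD character `χ (mod d′)`: `Σ_a χ(a){∞, a/d′}_f / (|Ω⁻(W)| i)` is `p`-integral. [cite: Kato2004Asterisque, Thm. 9.7 (p. 189)]
[cite: KimNakamura2020, Cor. 2.4] -/
theorem pint_twistedSymbolSum_div4 (hK : kato_neron_isIntegral_twistedSymbolSum_of_additive)
    (hp7 : 7 < p) (hadd : Addv W p) (hirr : Irr W p) (f : CuspForm (Gamma0 N) 2) (hf : IsNewformOf W f)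
    (hpN : p ^ 2 ∣ N)
    (hA : ∀ ℓ ∈ N.primeFactors, ¬ ℓ ^ 2 ∣ N →
      ((ℓ : ZMod p) / (W.LFunction ℓ : ZMod p)) ^ 2 ≠ 1)
    {d' : ℕ} (hd' : d'.Prime) (hNd' : N < d') (hpd' : ¬ p ∣ d' - 1)
    (hrd' : ∀ r : ℕ, r.Prime → r ≠ 2 → r ∣ p - 1 → ¬ r ∣ d' - 1) (h4d' : ¬ 4 ∣ d' - 1)
    {ϖ : ℚ} (hϖ : (ϖ : ℝ) * W.imaginaryPeriodRat = minusPeriod f)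
    (χ : DirichletCharacter ℂ d') (hχ : χ.Odd) :
    haveI : NeZero d' := ⟨hd'.ne_zero⟩
    ∃ s : ℕ, ¬ p ∣ s ∧ IsIntegral ℤ ((s : ℂ) *
      (twistedSymbolSum f χ / ((W.imaginaryPeriodRat : ℂ) * I))) := by
  haveI : NeZero d' := ⟨hd'.ne_zero⟩
  haveI : Fact d'.Prime := ⟨hd'⟩
  have hpP : p.Prime := hp.out
  have hN0 : N ≠ 0 := NeZero.ne N
  -- `χ ≠ 1`, primitive, of order prime to `p`
  have hχ1 : χ ≠ 1 := by
    intro h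
    have h1 : χ (-1) = -1 := hχ
    rw [h, MulChar.one_apply (isUnit_one.neg)] at h1
    norm_num at h1
  have hprim : χ.IsPrimitive := by
    rw [DirichletCharacter.isPrimitive_def]
    rcases (Nat.dvd_prime hd').mp (DirichletCharacter.conductor_dvd_level χ) with h | h
    · exact absurd (DirichletCharacter.eq_one_iff_conductor_eq_one.mpr h) hχ1
    · exact h
  have hord : ¬ p ∣ orderOf χ := by
    intro h
    have h1 : orderOf χ ∣ Fintype.card (DirichletCharacter ℂ d') := orderOf_dvd_card
    have h2 : Fintype.card (DirichletCharacter ℂ d') = d'.totient := by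
      rw [← Nat.card_eq_fintype_card]
      exact DirichletCharacter.card_eq_totient_of_hasEnoughRootsOfUnity ℂ d'
    rw [h2, Nat.totient_prime hd'] at h1
    exact hpd' (h.trans h1)
  have hpd'ne : p ≠ d' := by
    rintro rfl
    exact absurd (Nat.le_of_dvd (Nat.pos_of_ne_zero hN0) ((dvd_pow_self p two_ne_zero).trans hpN))
      (not_le.mpr hNd')
  have hm : d'.Coprime (p * N) := Nat.Coprime.mul_right ((Nat.coprime_primes hd' hpP).mpr hpd'ne.symm)
    ((hd'.coprime_iff_not_dvd).mpr fun h ↦ absurd (Nat.le_of_dvd (Nat.pos_of_ne_zero hN0) h)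
      (not_le.mpr hNd'))
  -- the value `r` and the fact
  have hΩf : 0 < minusPeriod f := IsNewform0.minusPeriod_pos_holds hf.1 hf.coeffField_eq_bot
  have hΩ : 0 < W.imaginaryPeriodRat := W.imaginaryPeriodRat_pos
  have hϖ0 : (ϖ : ℂ) ≠ 0 := by
    have : (ϖ : ℝ) ≠ 0 := by
      rintro h; rw [h, zero_mul] at hϖ; exact hΩf.ne' hϖ.symm
    exact_mod_cast this
  have hΩfC : ((minusPeriod f : ℝ) : ℂ) = (ϖ : ℂ) * (W.imaginaryPeriodRat : ℂ) := by
    rw [← hϖ]; push_cast; ring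
  set E : ℂ := ∏ ℓ ∈ N.primeFactors with ¬ ℓ ^ 2 ∣ N,
      (((ℓ : ℂ) - (W.LFunction ℓ : ℂ) * χ (ℓ : ZMod d')) *
        ((ℓ : ℂ) - (W.LFunction ℓ : ℂ) * (χ (ℓ : ZMod d'))⁻¹)) with hEdef
  set T : ℂ := twistedSymbolSum f χ with hTdef
  set r : ℂ := E * T / (((minusPeriod f : ℝ) : ℂ) * I) with hrdef
  have hden : ((minusPeriod f : ℝ) : ℂ) * I ≠ 0 :=
    mul_ne_zero (by exact_mod_cast hΩf.ne') I_ne_zero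
  have hval : E * T = r * ((minusPeriod f : ℝ) : ℂ) * I := by
    rw [hrdef, mul_assoc, div_mul_cancel₀ _ hden]
  obtain ⟨s, hs, hint⟩ :=
    (hK W f hf p hp7 hadd.1 hadd.2 hirr d' hm χ hprim hχ1 hord ϖ r).2 hχ hϖ hval
  -- `ϖ r = E · (T / (Ω i))`
  have hre : (ϖ : ℂ) * r = E * (T / ((W.imaginaryPeriodRat : ℂ) * I)) := by
    rw [hrdef, hΩfC]
    have hΩ0 : (W.imaginaryPeriodRat : ℂ) ≠ 0 := by exact_mod_cast hΩ.ne'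
    field_simp
  have hpint : ∃ s : ℕ, ¬ p ∣ s ∧ IsIntegral ℤ ((s : ℂ) * (E * (T / ((W.imaginaryPeriodRat : ℂ) * I)))) :=
    ⟨s, hs, by rw [← hre, ← mul_assoc]; exact hint⟩
  -- cancel the `p`-unit `E`
  have hEwt : ∃ (w : ℂ) (t : ℤ), IsIntegral ℤ w ∧ E * w = t ∧ ¬ (p : ℤ) ∣ t := by
    rw [hEdef]
    refine exists_prod_mul_eq hpP _ _ fun ℓ hℓ ↦ ?_
    obtain ⟨hℓN, hℓ2⟩ := Finset.mem_filter.mp hℓ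
    have hℓp : (Nat.prime_of_mem_primeFactors hℓN) = Nat.prime_of_mem_primeFactors hℓN := rfl
    have hℓprime := Nat.prime_of_mem_primeFactors hℓN
    have hℓne : ℓ ≠ p := by
      rintro rfl; exact hℓ2 hpN
    have hℓ0 : ((ℓ : ZMod p)) ≠ 0 := by
      rw [Ne, ZMod.natCast_eq_zero_iff]
      exact fun h ↦ hℓne ((Nat.prime_dvd_prime_iff_eq hpP hℓprime).mp h).symm
    -- `χ(ℓ)^{d′−1} = 1`
    have hℓd' : ((ℓ : ZMod d')) ≠ 0 := by
      rw [Ne, ZMod.natCast_eq_zero_iff]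
      exact fun h ↦ absurd (Nat.le_of_dvd hℓprime.pos h)
        (not_le.mpr ((Nat.le_of_dvd (Nat.pos_of_ne_zero hN0) (Nat.dvd_of_mem_primeFactors hℓN)).trans_lt hNd'))
    have hζ : (χ (ℓ : ZMod d')) ^ (d' - 1) = 1 := by
      rw [← map_pow, ZMod.pow_card_sub_one_eq_one hℓd', map_one]
    exact exists_symmEulerFactor_mul_eq_of_sq_ne_one ℓ (W.LFunction ℓ) hℓ0 (hA ℓ hℓN hℓ2)
      (Nat.sub_pos_of_lt hd'.one_lt) hrd' h4d' hζ
  obtain ⟨w, t, hw, hEw, ht⟩ := hEwt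
  exact pint_of_pint_mul_of_mul_eq hpP hw hEw ht hpint


end OneCharacterPlus

end Summit.BirchSwinnertonDyer.BirchSwinnertonDyer.Theorems.ManinFrameResidueProperRTameTwist

end
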